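import Literature.NumberTheory.DiophantineApproximation.PolylogHermitePade
import Mathlib.Analysis.SpecificLimits.Basic
import HarnessLib

/-!
# Type-I Hermite–Padé forms for `1, Li₁, …, Li_w`: vanishing, positivity and size of the kernel

Topic `Literature/NumberTheory/DiophantineApproximation`. Elementary facts about the weight-`w`
kernel `R^{(w)}_n(u) = (u − wn + 1)_{wn} / (u + 1)_{n+1}^w = ∏_{j<wn} (u − j) / ∏_{p ≤ n} (u + p + 1)^w`
(`PolylogPade.kernelW`) and the form `S^{(w)}_n(x) = ∑_{u ≥ 0} R^{(w)}_n(u) x^{u+1}`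
(`PolylogPade.formW`) of the sibling vocabulary file `PolylogHermitePade.lean`
(David–Hirata-Kohno–Kawashima 2020, Thm 2.1; Nikišin 1979; Hata 1990), the every-weight version
of `DilogHermitePadeBounds.lean`:

* `pochNum_natCast_eq_zero`, `kernelW_natCast_eq_zero` — the numerator `(u − wn + 1)_{wn}`, hence
  the kernel, vanishes at the naturals `u < wn` (the factor `s = wn − 1 − u` is zero);
* `pochDen_pos`, `pochNum_natCast_pos`, `pochNum_natCast_le_pow`, `pow_le_pochDen_pow`,
  `kernelW_natCast_pos`, `kernelW_natCast_nonneg`, `kernelW_natCast_le_one` — for naturals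
  `u ≥ wn` every factor of the numerator lies in `(0, u + 1]`, so
  `0 < (u − wn + 1)_{wn} ≤ (u+1)^{wn} ≤ (u+1)^{w(n+1)} ≤ (u+1)_{n+1}^w`, whence `0 < R^{(w)}_n(u) ≤ 1`;
  together with the vanishing, `0 ≤ R^{(w)}_n(u) ≤ 1` at every natural `u`;
* `kernelW_mul_self` — the first nonzero coefficient
  `R^{(w)}_n(wn) = (wn)! / ((wn+1)(wn+2)⋯((w+1)n+1))^w = (wn)!^{w+1} / ((w+1)n+1)!^w`;
* `summable_formW`, `formW_pos`, `formW_le_div`, `formW_le`, `formW_ge` — for `0 ≤ x < 1` the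
  series converges (comparison with the geometric series), `0 < S^{(w)}_n(x)` for `0 < x`,
  `S^{(w)}_n(x) ≤ x^{wn+1}/(1 − x)` (only the terms `u ≥ wn` survive and `R ≤ 1`), hence
  `S^{(w)}_n(x) ≤ x^{wn}` for `x ≤ 1/2`, and
  `S^{(w)}_n(x) ≥ R^{(w)}_n(wn) x^{wn+1} = (wn)!^{w+1}/((w+1)n+1)!^w · x^{wn+1}` (all terms are `≥ 0`).

With `x = 1/N` these give `0 < S^{(w)}_n(1/N) ≤ N^{−wn}`, the "analytic half" of the linear
independence argument for `1, Li₁(1/N), …, Li_w(1/N)`. Everything is proved from Mathlib; no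
definitions, no named facts.
-/

noncomputable section

open Finset

namespace Literature.NumberTheory.DiophantineApproximation

namespace PolylogPade

open Literature.NumberTheory.Transcendental

/-! ## The numerator and the denominator at naturals -/

/-- The numerator `(u − wn + 1)_{wn} = ∏_{s<wn} (u − wn + 1 + s)` vanishes at the naturals `u < wn`
(the factor `s = wn − 1 − u` is zero). [cite: DavidHirataKohnoKawashima2020, Thm 2.1] -/
theorem pochNum_natCast_eq_zero {w n u : ℕ} (hu : u < w * n) :
    BallRivoal.poch ((u : ℚ) - w * n + 1) (w * n) = 0 := by
  unfold BallRivoal.poch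
  refine Finset.prod_eq_zero (i := w * n - 1 - u) (Finset.mem_range.2 (by omega)) ?_
  have h : ((w * n - 1 - u : ℕ) : ℚ) = ((w * n : ℕ) : ℚ) - 1 - u := by
    rw [Nat.cast_sub (by omega), Nat.cast_sub (by omega)]
    push_cast
    ring
  rw [h]
  push_cast
  ring

/-- The denominator base `(u + 1)_{n+1} = ∏_{s ≤ n} (u + 1 + s)` is positive at every natural `u`.
[folklore] -/
theorem pochDen_pos (n u : ℕ) : 0 < BallRivoal.poch ((u : ℚ) + 1) (n + 1) :=
  Finset.prod_pos fun s _ => by positivity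

/-- For a natural `u ≥ wn` the numerator `(u − wn + 1)_{wn}` is positive (every factor is).
[cite: DavidHirataKohnoKawashima2020, Thm 2.1] -/
theorem pochNum_natCast_pos {w n u : ℕ} (hu : w * n ≤ u) :
    0 < BallRivoal.poch ((u : ℚ) - w * n + 1) (w * n) := by
  obtain ⟨d, rfl⟩ := Nat.exists_eq_add_of_le hu
  unfold BallRivoal.poch
  refine Finset.prod_pos fun s _ => ?_
  have hd : (0 : ℚ) ≤ d := d.cast_nonneg
  have hs : (0 : ℚ) ≤ s := s.cast_nonneg
  push_cast
  linarith

/-- For a natural `u ≥ wn` the numerator satisfies `(u − wn + 1)_{wn} ≤ (u + 1)^{wn}` (every factor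
lies in `[0, u + 1]`). [cite: DavidHirataKohnoKawashima2020, Thm 2.1] -/
theorem pochNum_natCast_le_pow {w n u : ℕ} (hu : w * n ≤ u) :
    BallRivoal.poch ((u : ℚ) - w * n + 1) (w * n) ≤ ((u : ℚ) + 1) ^ (w * n) := by
  obtain ⟨d, rfl⟩ := Nat.exists_eq_add_of_le hu
  unfold BallRivoal.poch
  calc ∏ s ∈ range (w * n), (((w * n + d : ℕ) : ℚ) - w * n + 1 + s)
      ≤ ∏ _s ∈ range (w * n), (((w * n + d : ℕ) : ℚ) + 1) := by
        refine Finset.prod_le_prod (fun s _ => ?_) (fun s hs => ?_)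
        · have hd : (0 : ℚ) ≤ d := d.cast_nonneg
          have hs : (0 : ℚ) ≤ s := s.cast_nonneg
          push_cast
          linarith
        · have hs' : (s : ℚ) < ((w * n : ℕ) : ℚ) := by exact_mod_cast Finset.mem_range.1 hs
          push_cast at hs' ⊢
          linarith
    _ = (((w * n + d : ℕ) : ℚ) + 1) ^ (w * n) := by rw [Finset.prod_const, Finset.card_range]

/-- At every natural `u` the denominator dominates:
`(u + 1)^{wn} ≤ (u + 1)^{w(n+1)} ≤ (u + 1)_{n+1}^w`. [folklore] -/
theorem pow_le_pochDen_pow (w n u : ℕ) :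
    ((u : ℚ) + 1) ^ (w * n) ≤ BallRivoal.poch ((u : ℚ) + 1) (n + 1) ^ w := by
  have hu0 : (0 : ℚ) ≤ (u : ℚ) + 1 := by positivity
  have hu1 : (1 : ℚ) ≤ (u : ℚ) + 1 := by
    have := (u.cast_nonneg : (0 : ℚ) ≤ u)
    linarith
  calc ((u : ℚ) + 1) ^ (w * n) ≤ ((u : ℚ) + 1) ^ (w * (n + 1)) :=
        pow_le_pow_right₀ hu1 (Nat.mul_le_mul_left w (Nat.le_succ n))
    _ = (((u : ℚ) + 1) ^ (n + 1)) ^ w := pow_mul' _ _ _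
    _ ≤ BallRivoal.poch ((u : ℚ) + 1) (n + 1) ^ w := by
        refine pow_le_pow_left₀ (pow_nonneg hu0 _) ?_ w
        unfold BallRivoal.poch
        calc ((u : ℚ) + 1) ^ (n + 1) = ∏ _s ∈ range (n + 1), ((u : ℚ) + 1) := by
              rw [Finset.prod_const, Finset.card_range]
          _ ≤ ∏ s ∈ range (n + 1), ((u : ℚ) + 1 + s) :=
              Finset.prod_le_prod (fun s _ => hu0) fun s _ => by
                have := (s.cast_nonneg : (0 : ℚ) ≤ s)
                linarith

/-! ## The kernel at naturals -/

/-- The kernel `R^{(w)}_n(u)` vanishes at the naturals `u < wn`: the series `S^{(w)}_n(x)` starts at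
`x^{wn+1}`. [cite: DavidHirataKohnoKawashima2020, Thm 2.1] -/
theorem kernelW_natCast_eq_zero {w n u : ℕ} (hu : u < w * n) : kernelW w n u = 0 := by
  rw [kernelW, pochNum_natCast_eq_zero hu, zero_div]

/-- The kernel `R^{(w)}_n(u)` is positive at the naturals `u ≥ wn`.
[cite: DavidHirataKohnoKawashima2020, Thm 2.1] -/
theorem kernelW_natCast_pos {w n u : ℕ} (hu : w * n ≤ u) : 0 < kernelW w n u := by
  unfold kernelW
  exact div_pos (pochNum_natCast_pos hu) (pow_pos (pochDen_pos n u) w)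

/-- The kernel `R^{(w)}_n(u)` is nonnegative at every natural `u`.
[cite: DavidHirataKohnoKawashima2020, Thm 2.1] -/
theorem kernelW_natCast_nonneg (w n u : ℕ) : 0 ≤ kernelW w n u := by
  rcases lt_or_ge u (w * n) with h | h
  · rw [kernelW_natCast_eq_zero h]
  · exact (kernelW_natCast_pos h).le

/-- The kernel satisfies `R^{(w)}_n(u) ≤ 1` at every natural `u`
(`0 ≤ num ≤ (u+1)^{wn} ≤ den` for `u ≥ wn`, and `R^{(w)}_n(u) = 0` for `u < wn`).
[cite: DavidHirataKohnoKawashima2020, Thm 2.1] -/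
theorem kernelW_natCast_le_one (w n u : ℕ) : kernelW w n u ≤ 1 := by
  rcases lt_or_ge u (w * n) with h | h
  · rw [kernelW_natCast_eq_zero h]
    exact zero_le_one
  · unfold kernelW
    exact div_le_one_of_le₀ ((pochNum_natCast_le_pow h).trans (pow_le_pochDen_pow w n u))
      (pow_pos (pochDen_pos n u) w).le

/-- `0 ≤ R^{(w)}_n(u)` at every natural `u`, as a real number (cast of `kernelW_natCast_nonneg`).
[cite: DavidHirataKohnoKawashima2020, Thm 2.1] -/
theorem kernelW_realCast_nonneg (w n u : ℕ) : (0 : ℝ) ≤ (kernelW w n u : ℝ) := by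
  exact_mod_cast kernelW_natCast_nonneg w n u

/-- `R^{(w)}_n(u) ≤ 1` at every natural `u`, as a real number (cast of `kernelW_natCast_le_one`):
the coefficients of `S^{(w)}_n` are bounded by `1`, so the series converges absolutely for `|x| < 1`.
[cite: DavidHirataKohnoKawashima2020, Thm 2.1] -/
theorem kernelW_realCast_le_one (w n u : ℕ) : (kernelW w n u : ℝ) ≤ 1 := by
  exact_mod_cast kernelW_natCast_le_one w n u

/-! ## The first nonzero coefficient -/

/-- The numerator at `u = wn` is `∏_{s<wn} (s + 1) = (wn)!`.
[cite: DavidHirataKohnoKawashima2020, Thm 2.1] -/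
theorem pochNum_self (w n : ℕ) :
    BallRivoal.poch (((w * n : ℕ) : ℚ) - w * n + 1) (w * n) = ((w * n).factorial : ℚ) := by
  unfold BallRivoal.poch
  rw [← Finset.prod_range_add_one_eq_factorial, Nat.cast_prod]
  refine Finset.prod_congr rfl fun s _ => ?_
  push_cast
  ring

/-- `(wn + 1)_{n+1} · (wn)! = ((w+1)n + 1)!` (Mathlib's `Nat.factorial_mul_ascFactorial`).
[folklore] -/
theorem pochDen_self_mul_factorial (w n : ℕ) :
    BallRivoal.poch (((w * n : ℕ) : ℚ) + 1) (n + 1) * ((w * n).factorial : ℚ) =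
      (((w + 1) * n + 1).factorial : ℚ) := by
  have h := Nat.factorial_mul_ascFactorial (w * n) (n + 1)
  rw [Nat.ascFactorial_eq_prod_range, show w * n + (n + 1) = (w + 1) * n + 1 by ring] at h
  rw [mul_comm]
  unfold BallRivoal.poch
  have h' : ∀ s ∈ range (n + 1), (((w * n : ℕ) : ℚ) + 1 + (s : ℚ)) = ((w * n + 1 + s : ℕ) : ℚ) := by
    intro s _
    push_cast
    ring
  rw [Finset.prod_congr rfl h', ← Nat.cast_prod]
  exact_mod_cast h

/-- **The first nonzero coefficient of `S^{(w)}_n`**: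
`R^{(w)}_n(wn) = (wn)! / ((wn+1)(wn+2)⋯((w+1)n+1))^w = (wn)!^{w+1} / ((w+1)n+1)!^w`.
[cite: DavidHirataKohnoKawashima2020, Thm 2.1] -/
theorem kernelW_mul_self (w n : ℕ) :
    kernelW w n ((w * n : ℕ) : ℚ) =
      ((w * n).factorial : ℚ) ^ (w + 1) / ((((w + 1) * n + 1).factorial : ℚ) ^ w) := by
  have hP : 0 < BallRivoal.poch (((w * n : ℕ) : ℚ) + 1) (n + 1) := pochDen_pos n (w * n)
  have hf : (0 : ℚ) < (w * n).factorial := by exact_mod_cast Nat.factorial_pos _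
  rw [kernelW, pochNum_self, ← pochDen_self_mul_factorial,
    div_eq_div_iff (pow_ne_zero _ hP.ne') (pow_ne_zero _ (mul_ne_zero hP.ne' hf.ne'))]
  ring

/-! ## Convergence and the two-sided bounds for `S^{(w)}_n(x)` -/

/-- For `0 ≤ x < 1` the series `S^{(w)}_n(x) = ∑_{u ≥ 0} R^{(w)}_n(u) x^{u+1}` converges (its terms
lie between `0` and those of the geometric series). [cite: DavidHirataKohnoKawashima2020, Thm 2.1] -/
theorem summable_formW (w n : ℕ) {x : ℝ} (hx : 0 ≤ x) (hx1 : x < 1) :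
    Summable fun u : ℕ => (kernelW w n u : ℝ) * x ^ (u + 1) := by
  have hg : Summable fun u : ℕ => x ^ (u + 1) := by
    simp_rw [pow_succ]
    exact (summable_geometric_of_lt_one hx hx1).mul_right x
  refine Summable.of_nonneg_of_le (fun u => ?_) (fun u => ?_) hg
  · exact mul_nonneg (kernelW_realCast_nonneg w n u) (pow_nonneg hx _)
  · exact mul_le_of_le_one_left (pow_nonneg hx _) (kernelW_realCast_le_one w n u)

/-- **Positivity**: `0 < S^{(w)}_n(x)` for `0 < x < 1` (all terms are `≥ 0` and the term `u = wn`
is `> 0`). [cite: DavidHirataKohnoKawashima2020, Thm 2.1] -/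
theorem formW_pos (w n : ℕ) {x : ℝ} (hx : 0 < x) (hx1 : x < 1) : 0 < formW w n x := by
  unfold formW
  have hwn : (0 : ℝ) < (kernelW w n ((w * n : ℕ) : ℚ) : ℝ) := by
    exact_mod_cast kernelW_natCast_pos le_rfl
  exact (summable_formW w n hx.le hx1).tsum_pos
    (fun u => mul_nonneg (kernelW_realCast_nonneg w n u) (pow_nonneg hx.le _)) (w * n)
    (mul_pos hwn (pow_pos hx _))

/-- **Tail bound**: `S^{(w)}_n(x) ≤ x^{wn+1} / (1 − x)` for `0 ≤ x < 1` (the terms `u < wn` vanish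
and `0 ≤ R^{(w)}_n(u) ≤ 1` for the others, so `S^{(w)}_n(x) ≤ ∑_{u ≥ wn} x^{u+1}`).
[cite: DavidHirataKohnoKawashima2020, Thm 2.1] -/
theorem formW_le_div (w n : ℕ) {x : ℝ} (hx : 0 ≤ x) (hx1 : x < 1) :
    formW w n x ≤ x ^ (w * n + 1) / (1 - x) := by
  have hs := summable_formW w n hx hx1
  have h0 : ∑ u ∈ range (w * n), (kernelW w n u : ℝ) * x ^ (u + 1) = 0 :=
    Finset.sum_eq_zero fun u hu => by
      rw [kernelW_natCast_eq_zero (Finset.mem_range.1 hu), Rat.cast_zero, zero_mul]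
  have hs' : Summable fun u : ℕ =>
      (kernelW w n ((u + w * n : ℕ) : ℚ) : ℝ) * x ^ (u + w * n + 1) :=
    (summable_nat_add_iff (f := fun u : ℕ => (kernelW w n u : ℝ) * x ^ (u + 1)) (w * n)).2 hs
  have hg : Summable fun u : ℕ => x ^ (w * n + 1) * x ^ u :=
    (summable_geometric_of_lt_one hx hx1).mul_left _
  unfold formW
  rw [← hs.sum_add_tsum_nat_add (w * n), h0, zero_add]
  calc ∑' u : ℕ, (kernelW w n ((u + w * n : ℕ) : ℚ) : ℝ) * x ^ (u + w * n + 1)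
      ≤ ∑' u : ℕ, x ^ (w * n + 1) * x ^ u := by
        refine hs'.tsum_le_tsum (fun u => ?_) hg
        calc (kernelW w n ((u + w * n : ℕ) : ℚ) : ℝ) * x ^ (u + w * n + 1)
            ≤ x ^ (u + w * n + 1) :=
              mul_le_of_le_one_left (pow_nonneg hx _) (kernelW_realCast_le_one w n (u + w * n))
          _ = x ^ (w * n + 1) * x ^ u := by rw [← pow_add]; congr 1; ring
    _ = x ^ (w * n + 1) / (1 - x) := by
        rw [tsum_mul_left, tsum_geometric_of_lt_one hx hx1, div_eq_mul_inv]

/-- **Upper bound**: `S^{(w)}_n(x) ≤ x^{wn}` for `0 ≤ x ≤ 1/2`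
(`S^{(w)}_n(x) ≤ x^{wn+1}/(1 − x) ≤ x^{wn}` as `x ≤ 1 − x`); at `x = 1/N`, `N ≥ 2`, this is
`S^{(w)}_n(1/N) ≤ N^{−wn}`. [cite: DavidHirataKohnoKawashima2020, Thm 2.1] -/
theorem formW_le (w n : ℕ) {x : ℝ} (hx : 0 ≤ x) (hx1 : x ≤ 1 / 2) : formW w n x ≤ x ^ (w * n) := by
  have hx1' : x < 1 := by linarith
  refine (formW_le_div w n hx hx1').trans ?_
  rw [div_le_iff₀ (by linarith), pow_succ]
  exact mul_le_mul_of_nonneg_left (by linarith) (pow_nonneg hx _)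

/-- **Lower bound**: `S^{(w)}_n(x) ≥ R^{(w)}_n(wn) x^{wn+1} = (wn)!^{w+1}/((w+1)n+1)!^w · x^{wn+1}`
for `0 ≤ x < 1` (all terms are nonnegative; keep the first nonzero one).
[cite: DavidHirataKohnoKawashima2020, Thm 2.1] -/
theorem formW_ge (w n : ℕ) {x : ℝ} (hx : 0 ≤ x) (hx1 : x < 1) :
    ((w * n).factorial : ℝ) ^ (w + 1) / ((((w + 1) * n + 1).factorial : ℝ) ^ w) * x ^ (w * n + 1) ≤
      formW w n x := by
  have h : (kernelW w n ((w * n : ℕ) : ℚ) : ℝ) =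
      ((w * n).factorial : ℝ) ^ (w + 1) / ((((w + 1) * n + 1).factorial : ℝ) ^ w) := by
    rw [kernelW_mul_self]
    push_cast
    rfl
  rw [formW, ← h]
  exact (summable_formW w n hx hx1).le_tsum (w * n) fun u _ =>
    mul_nonneg (kernelW_realCast_nonneg w n u) (pow_nonneg hx _)

end PolylogPade

end Literature.NumberTheory.DiophantineApproximation
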